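import Literature.NumberTheory.Automorphic.BrandtModule
import HarnessLib

/-!
# Localisation of `ℤ`-lattices at a prime, the local–global principle, canonical inverses and
# invertibility of right ideals from local data

First layer of the proof files for the named fact `brandtMatrix_comm` of
`Literature/NumberTheory/Automorphic/BrandtModule.lean` (commutativity of the Brandt matrices
`B(m)`, `B(n)` of an Eichler order for `m, n` prime to the level: Vignéras, *Arithmétique des
algèbres de quaternions*, LNM 800, Ch. III §5 exercice 5.8 (c)–(d); Eichler, LNM 320 (1973),
Ch. II §6 Thm. 2 (18)–(19)). The printed proofs rest on the **local–global dictionary for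
lattices** (Vignéras III §5 A, Prop. 5.1: a lattice is determined by, and can be prescribed
through, its localisations `I_p`) and on the multiplication rules for (locally principal, hence
invertible) ideals of Eichler orders (Vignéras I §4 p. 21, III §5 B). This file sets both up in
the most elementary form that suffices, *inside* the ambient ring `B`, without completions or
localised rings:

* `locAt p L = {x ∈ B | k x ∈ L for some k coprime to p}` — the trace on `B` of `ℤ_(p) L` (for
  `p` prime); `locPow d L = {x | d ^ t x ∈ L for some t}` — the trace of `ℤ[1/d] L`;
  monotone, idempotent, compatible with `⊓`, with products (`locAt_mul`), with left/right orders
  of finitely generated lattices (`leftOrderOf_locAt`, `rightOrderOf_locAt`), with translations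
  (`locAt_units_smul`, `locAt_op_smul`); the comparison lemma `locAt_eq_of_smul_le`; and the
  **local–global principle** `eq_of_forall_locAt_eq` (two submodules with the same localisation
  at every prime are equal: the `k ∈ ℤ` with `k x ∈ M` form an ideal of `ℤ` in no `(p)`).
* `linv O I = {x ∈ B | x I ⊆ O}` — the canonical inverse; for an invertible right `O`-ideal `I`
  (`IsInvertibleRightIdeal`: full lattice, right order exactly `O`, *some* two-sided inverse)
  the multiplication rules hold for it: `IsInvertibleRightIdeal.mul_linv` (`I I⁻¹ = O_ℓ(I)`),
  `IsInvertibleRightIdeal.linv_mul` (`I⁻¹ I = O`); orders are invertible ideals of themselves.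
* the **gluing criterion** `IsInvertibleRightIdeal.of_locAt`: a full lattice `M` which at every
  prime has the localisation of some invertible right `O`-ideal `J_p`, together with a candidate
  inverse `M'` localising to `linv O J_p`, is an invertible right `O`-ideal — the form in which
  "les idéaux sont localement principaux, donc inversibles" (Vignéras III §5 B) enters the
  Brandt-matrix identities (heredity of the Eichler order at primes not dividing the level).

Everything here holds in an arbitrary ring `B`; no quaternionic input. (The sibling
`BrandtModuleProofs.lean` proves the multiplicativity `B(mn) = B(m) B(n)`, `(m, n) = 1`, by a
global argument; the localisation set up here is what the *same-prime* relations need.)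

## References

* M.-F. Vignéras, *Arithmétique des algèbres de quaternions*, LNM 800 (1980), Ch. I §4
  (Lemme 4.3, règles de multiplication p. 21), Ch. III §5 A (Prop. 5.1) and §5 B [VignerasLNM800].
* I. Reiner, *Maximal Orders* (1975), §§3–5 (localisation of lattices) — background.
-/

noncomputable section

open scoped Pointwise

universe u

namespace Literature.NumberTheory.Automorphic

variable {B : Type u} [Ring B]

/-! ### Element-wise localisation at `p` -/

/-- **Localisation of a lattice at `p`, inside `B`**: `locAt p L = {x | ∃ k coprime to p, k • x ∈ L}`.
For a prime `p` and a `ℤ`-lattice `L` in a `ℚ`-algebra this is `B ∩ ℤ_(p) L = ℤ_(p) L`, the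
localisation of Vignéras III §5 A read inside `B`. [cite: VignerasLNM800, Ch. III §5 A (localisés d'un réseau)] -/
def locAt (p : ℕ) (L : Submodule ℤ B) : Submodule ℤ B where
  carrier := {x | ∃ k : ℕ, k.Coprime p ∧ (k : ℤ) • x ∈ L}
  add_mem' := by
    rintro x y ⟨k, hk, hkx⟩ ⟨l, hl, hly⟩
    refine ⟨k * l, Nat.Coprime.mul_left hk hl, ?_⟩
    rw [smul_add]
    refine add_mem ?_ ?_
    · rw [Nat.cast_mul, mul_comm, mul_smul]
      exact L.smul_mem _ hkx
    · rw [Nat.cast_mul, mul_smul]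
      exact L.smul_mem _ hly
  zero_mem' := ⟨1, Nat.coprime_one_left p, by rw [smul_zero]; exact zero_mem L⟩
  smul_mem' := by
    rintro n x ⟨k, hk, hkx⟩
    refine ⟨k, hk, ?_⟩
    rw [smul_comm]
    exact L.smul_mem n hkx

/-- Membership in `locAt p L` (definitional). [folklore] -/
theorem mem_locAt {p : ℕ} {L : Submodule ℤ B} {x : B} :
    x ∈ locAt p L ↔ ∃ k : ℕ, k.Coprime p ∧ (k : ℤ) • x ∈ L := Iff.rfl

/-- `L ≤ locAt p L` (`k = 1`). [folklore] -/
theorem le_locAt (p : ℕ) (L : Submodule ℤ B) : L ≤ locAt p L := fun x hx =>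
  ⟨1, Nat.coprime_one_left p, by rw [Nat.cast_one, one_smul]; exact hx⟩

/-- `locAt p` is monotone. [folklore] -/
theorem locAt_mono (p : ℕ) {L M : Submodule ℤ B} (h : L ≤ M) : locAt p L ≤ locAt p M :=
  fun _ ⟨k, hk, hkx⟩ => ⟨k, hk, h hkx⟩

/-- If `k • x ∈ locAt p L` with `k` coprime to `p` then `x ∈ locAt p L`. [folklore] -/
theorem mem_locAt_of_smul_mem {p : ℕ} {L : Submodule ℤ B} {x : B} {k : ℕ} (hk : k.Coprime p)
    (hx : (k : ℤ) • x ∈ locAt p L) : x ∈ locAt p L := by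
  obtain ⟨l, hl, hlx⟩ := hx
  refine ⟨l * k, Nat.Coprime.mul_left hl hk, ?_⟩
  rwa [Nat.cast_mul, mul_smul]

/-- `locAt p` is idempotent. [folklore] -/
@[simp] theorem locAt_locAt (p : ℕ) (L : Submodule ℤ B) : locAt p (locAt p L) = locAt p L := by
  refine le_antisymm ?_ (le_locAt p _)
  rintro x ⟨k, hk, hkx⟩
  exact mem_locAt_of_smul_mem hk hkx

/-- `locAt p L ≤ locAt p M ↔ L ≤ locAt p M`. [folklore] -/
theorem locAt_le_locAt_iff {p : ℕ} {L M : Submodule ℤ B} : locAt p L ≤ locAt p M ↔ L ≤ locAt p M :=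
  ⟨fun h => (le_locAt p L).trans h, fun h => (locAt_mono p h).trans_eq (locAt_locAt p M)⟩

/-- `locAt p` commutes with binary intersections. [folklore] -/
theorem locAt_inf (p : ℕ) (L M : Submodule ℤ B) : locAt p (L ⊓ M) = locAt p L ⊓ locAt p M := by
  refine le_antisymm (le_inf (locAt_mono p inf_le_left) (locAt_mono p inf_le_right)) ?_
  rintro x ⟨⟨k, hk, hkx⟩, ⟨l, hl, hlx⟩⟩
  refine ⟨k * l, Nat.Coprime.mul_left hk hl, ?_, ?_⟩
  · rw [Nat.cast_mul, mul_comm, mul_smul]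
    exact L.smul_mem _ hkx
  · rw [Nat.cast_mul, mul_smul]
    exact M.smul_mem _ hlx

/-- **Comparison lemma**: if `L ≤ M` and `d • M ≤ L` for some `d` coprime to `p`, then `L` and
`M` have the same localisation at `p`. [folklore] -/
theorem locAt_eq_of_smul_le {p : ℕ} {L M : Submodule ℤ B} (hLM : L ≤ M) {d : ℕ} (hd : d.Coprime p)
    (hdM : ∀ x ∈ M, (d : ℤ) • x ∈ L) : locAt p L = locAt p M := by
  refine le_antisymm (locAt_mono p hLM) ?_
  rintro x ⟨k, hk, hkx⟩
  refine ⟨d * k, Nat.Coprime.mul_left hd hk, ?_⟩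
  rw [Nat.cast_mul, mul_smul]
  exact hdM _ hkx

/-- The localisation at `p` of the whole ring is the whole ring. [folklore] -/
@[simp] theorem locAt_top (p : ℕ) : locAt p (⊤ : Submodule ℤ B) = ⊤ :=
  top_le_iff.mp (le_locAt p ⊤)

/-! ### Products, orders, translates -/

/-- `locAt p L * locAt p M ≤ locAt p (L * M)`. [folklore] -/
theorem locAt_mul_locAt_le (p : ℕ) (L M : Submodule ℤ B) :
    locAt p L * locAt p M ≤ locAt p (L * M) := by
  rw [Submodule.mul_le]
  rintro x ⟨k, hk, hkx⟩ y ⟨l, hl, hly⟩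
  refine ⟨k * l, Nat.Coprime.mul_left hk hl, ?_⟩
  have : ((k * l : ℕ) : ℤ) • (x * y) = ((k : ℤ) • x) * ((l : ℤ) • y) := by
    rw [smul_mul_assoc, mul_smul_comm, ← mul_smul, Nat.cast_mul]
  rw [this]
  exact Submodule.mul_mem_mul hkx hly

/-- **Localisation commutes with products**: `(L M)_p = (L_p M_p)_p`. [folklore] -/
theorem locAt_mul (p : ℕ) (L M : Submodule ℤ B) :
    locAt p (L * M) = locAt p (locAt p L * locAt p M) :=
  le_antisymm (locAt_mono p (mul_le_mul' (le_locAt p L) (le_locAt p M)))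
    (locAt_le_locAt_iff.mpr (locAt_mul_locAt_le p L M))

/-- Products only depend on the localisations of the factors. [folklore] -/
theorem locAt_mul_congr (p : ℕ) {L L' M M' : Submodule ℤ B} (hL : locAt p L = locAt p L')
    (hM : locAt p M = locAt p M') : locAt p (L * M) = locAt p (L' * M') := by
  rw [locAt_mul, hL, hM, ← locAt_mul]

/-- `(O_r L)_p ≤ O_r(L_p)` for every submodule `L`. [folklore] -/
theorem locAt_rightOrderOf_le (p : ℕ) (L : Submodule ℤ B) :
    locAt p (rightOrderOf L) ≤ rightOrderOf (locAt p L) := by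
  rintro x ⟨k, hk, hkx⟩ y ⟨l, hl, hly⟩
  refine ⟨l * k, Nat.Coprime.mul_left hl hk, ?_⟩
  have : ((l * k : ℕ) : ℤ) • (y * x) = ((l : ℤ) • y) * ((k : ℤ) • x) := by
    rw [smul_mul_assoc, mul_smul_comm, ← mul_smul, Nat.cast_mul]
  rw [this]
  exact hkx _ hly

/-- `(O_ℓ L)_p ≤ O_ℓ(L_p)` for every submodule `L`. [folklore] -/
theorem locAt_leftOrderOf_le (p : ℕ) (L : Submodule ℤ B) :
    locAt p (leftOrderOf L) ≤ leftOrderOf (locAt p L) := by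
  rintro x ⟨k, hk, hkx⟩ y ⟨l, hl, hly⟩
  refine ⟨k * l, Nat.Coprime.mul_left hk hl, ?_⟩
  have : ((k * l : ℕ) : ℤ) • (x * y) = ((k : ℤ) • x) * ((l : ℤ) • y) := by
    rw [smul_mul_assoc, mul_smul_comm, ← mul_smul, Nat.cast_mul]
  rw [this]
  exact hkx _ hly

/-- A common "denominator" for finitely many elements of a localisation: if every element of a
finite set `s` lies in `locAt p M`, some `k` coprime to `p` multiplies all of `span s` into `M`.
[folklore] -/
theorem exists_smul_span_le_of_subset_locAt {p : ℕ} {M : Submodule ℤ B} (s : Finset B)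
    (hs : ∀ x ∈ s, x ∈ locAt p M) :
    ∃ k : ℕ, k.Coprime p ∧ ∀ x ∈ Submodule.span ℤ (s : Set B), (k : ℤ) • x ∈ M := by
  classical
  choose! k hk hkx using hs
  refine ⟨∏ x ∈ s, k x, Nat.Coprime.prod_left fun x hx => hk x hx, fun x hx => ?_⟩
  refine Submodule.span_induction (fun x hx => ?_) (by rw [smul_zero]; exact zero_mem M)
    (fun x y _ _ hx hy => by rw [smul_add]; exact add_mem hx hy)
    (fun n x _ hx => by rw [smul_comm]; exact M.smul_mem n hx) hx
  have hx' : x ∈ s := hx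
  rw [← Finset.prod_erase_mul _ _ hx', Nat.cast_mul, mul_smul]
  exact M.smul_mem _ (hkx x hx')

/-- **Localisation commutes with the right order** of a finitely generated lattice:
`O_r(L_p) = (O_r L)_p`. [folklore] -/
theorem rightOrderOf_locAt (p : ℕ) {L : Submodule ℤ B} (hL : L.FG) :
    rightOrderOf (locAt p L) = locAt p (rightOrderOf L) := by
  classical
  refine le_antisymm ?_ (locAt_rightOrderOf_le p L)
  intro x hx
  obtain ⟨s, hs⟩ := hL
  have hmem : ∀ y ∈ s, y * x ∈ locAt p L := fun y hy =>
    hx y (le_locAt p L (hs ▸ Submodule.subset_span hy))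
  obtain ⟨k, hk, hkx⟩ := exists_smul_span_le_of_subset_locAt (M := L)
    (s.image fun y => y * x) (by simpa using hmem)
  refine ⟨k, hk, fun y hy => ?_⟩
  rw [mul_smul_comm]
  refine hkx _ ?_
  rw [← hs] at hy
  refine Submodule.span_induction (fun z hz => Submodule.subset_span ?_) (by rw [zero_mul]; exact zero_mem _)
    (fun a b _ _ ha hb => by rw [add_mul]; exact add_mem ha hb)
    (fun n a _ ha => by rw [smul_mul_assoc]; exact Submodule.smul_mem _ n ha) hy
  exact Finset.mem_coe.mpr (Finset.mem_image.mpr ⟨z, hz, rfl⟩)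

/-- **Localisation commutes with the left order** of a finitely generated lattice:
`O_ℓ(L_p) = (O_ℓ L)_p`. [folklore] -/
theorem leftOrderOf_locAt (p : ℕ) {L : Submodule ℤ B} (hL : L.FG) :
    leftOrderOf (locAt p L) = locAt p (leftOrderOf L) := by
  classical
  refine le_antisymm ?_ (locAt_leftOrderOf_le p L)
  intro x hx
  obtain ⟨s, hs⟩ := hL
  have hmem : ∀ y ∈ s, x * y ∈ locAt p L := fun y hy =>
    hx y (le_locAt p L (hs ▸ Submodule.subset_span hy))
  obtain ⟨k, hk, hkx⟩ := exists_smul_span_le_of_subset_locAt (M := L)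
    (s.image fun y => x * y) (by simpa using hmem)
  refine ⟨k, hk, fun y hy => ?_⟩
  rw [smul_mul_assoc]
  refine hkx _ ?_
  rw [← hs] at hy
  refine Submodule.span_induction (fun z hz => Submodule.subset_span ?_) (by rw [mul_zero]; exact zero_mem _)
    (fun a b _ _ ha hb => by rw [mul_add]; exact add_mem ha hb)
    (fun n a _ ha => by rw [mul_smul_comm]; exact Submodule.smul_mem _ n ha) hy
  exact Finset.mem_coe.mpr (Finset.mem_image.mpr ⟨z, hz, rfl⟩)

/-- Localisation commutes with left translation by a unit: `(b L)_p = b L_p`. [folklore] -/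
theorem locAt_units_smul (p : ℕ) (b : Bˣ) (L : Submodule ℤ B) :
    locAt p (b • L) = b • locAt p L := by
  ext x
  rw [mem_units_smul_submodule_iff, mem_locAt, mem_locAt]
  refine exists_congr fun k => and_congr_right fun _ => ?_
  rw [mem_units_smul_submodule_iff, smul_comm]

/-- Localisation commutes with right translation: `(L c)_p = L_p c` (`c` acting through
`Bᵐᵒᵖ`). [folklore] -/
theorem locAt_op_smul (p : ℕ) (c : Bˣ) (L : Submodule ℤ B) :
    locAt p (MulOpposite.op (c : B) • L) = MulOpposite.op (c : B) • locAt p L := by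
  ext x
  rw [mem_op_units_smul_submodule_iff, mem_locAt, mem_locAt]
  refine exists_congr fun k => and_congr_right fun _ => ?_
  rw [mem_op_units_smul_submodule_iff, smul_mul_assoc]

/-! ### The local–global principle -/

/-- **Local–global principle for submodules** (Vignéras III §5 A, Prop. 5.1, in element-wise
form): if `x ∈ locAt p M` for every prime `p` then `x ∈ M` — the integers `k` with `k x ∈ M`
form an ideal of `ℤ` contained in no `(p)`. [cite: VignerasLNM800, Ch. III §5 A Prop. 5.1] -/
theorem mem_of_forall_prime_mem_locAt {M : Submodule ℤ B} {x : B}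
    (h : ∀ p : ℕ, p.Prime → x ∈ locAt p M) : x ∈ M := by
  classical
  -- the ideal `S = {k | k • x ∈ M}` of `ℤ`
  let S : Ideal ℤ := M.comap (LinearMap.toSpanSingleton ℤ B x)
  have hS : ∀ k : ℤ, k ∈ S ↔ k • x ∈ M := fun k => Iff.rfl
  obtain ⟨g, hg⟩ := (IsPrincipalIdealRing.principal S).principal
  have hgS : ∀ k : ℤ, k ∈ S ↔ g ∣ k := fun k => by
    rw [hg, Ideal.submodule_span_eq, Ideal.mem_span_singleton]
  by_cases h1 : g.natAbs = 1
  · have h1S : (1 : ℤ) ∈ S := (hgS 1).mpr (Int.natAbs_dvd.mp (by rw [h1]; exact one_dvd _))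
    rw [hS, one_smul] at h1S
    exact h1S
  · exfalso
    obtain ⟨p, hp, hpg⟩ := Nat.exists_prime_and_dvd h1
    obtain ⟨k, hk, hkx⟩ := h p hp
    have hgk : g ∣ (k : ℤ) := (hgS k).mp ((hS k).mpr hkx)
    have hpk : p ∣ k := by
      have : (g.natAbs : ℤ) ∣ (k : ℤ) := Int.natAbs_dvd.mpr hgk
      exact_mod_cast (Int.natCast_dvd_natCast.mp (dvd_trans (Int.natCast_dvd_natCast.mpr hpg) this))
    exact hp.one_lt.ne' (Nat.Coprime.eq_one_of_dvd (Nat.Coprime.coprime_dvd_left hpk hk) (dvd_refl p))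

/-- **Local–global principle**: `M ≤ N` as soon as `locAt p M ≤ locAt p N` for all primes `p`. [cite: VignerasLNM800, Ch. III §5 A Prop. 5.1] -/
theorem le_of_forall_locAt_le {M N : Submodule ℤ B}
    (h : ∀ p : ℕ, p.Prime → locAt p M ≤ locAt p N) : M ≤ N := fun _ hx =>
  mem_of_forall_prime_mem_locAt fun p hp => h p hp (le_locAt p M hx)

/-- **Local–global principle**: two submodules with the same localisations at all primes are
equal (Vignéras III §5 A, Prop. 5.1). [cite: VignerasLNM800, Ch. III §5 A Prop. 5.1] -/
theorem eq_of_forall_locAt_eq {M N : Submodule ℤ B}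
    (h : ∀ p : ℕ, p.Prime → locAt p M = locAt p N) : M = N :=
  le_antisymm (le_of_forall_locAt_le fun p hp => (h p hp).le)
    (le_of_forall_locAt_le fun p hp => (h p hp).ge)

/-! ### `locPow`: inverting one integer -/

/-- **Localisation away from `d`**, inside `B`: `locPow d L = {x | d ^ t • x ∈ L for some t}`, the
trace on `B` of `ℤ[1/d] L`. [folklore] -/
def locPow (d : ℕ) (L : Submodule ℤ B) : Submodule ℤ B where
  carrier := {x | ∃ t : ℕ, ((d ^ t : ℕ) : ℤ) • x ∈ L}
  add_mem' := by
    rintro x y ⟨s, hsx⟩ ⟨t, hty⟩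
    refine ⟨s + t, ?_⟩
    rw [smul_add]
    refine add_mem ?_ ?_
    · rw [pow_add, Nat.cast_mul, mul_comm, mul_smul]
      exact L.smul_mem _ hsx
    · rw [pow_add, Nat.cast_mul, mul_smul]
      exact L.smul_mem _ hty
  zero_mem' := ⟨0, by rw [smul_zero]; exact zero_mem L⟩
  smul_mem' := by
    rintro n x ⟨t, htx⟩
    refine ⟨t, ?_⟩
    rw [smul_comm]
    exact L.smul_mem n htx

/-- Membership in `locPow d L` (definitional). [folklore] -/
theorem mem_locPow {d : ℕ} {L : Submodule ℤ B} {x : B} :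
    x ∈ locPow d L ↔ ∃ t : ℕ, ((d ^ t : ℕ) : ℤ) • x ∈ L := Iff.rfl

/-- `L ≤ locPow d L`. [folklore] -/
theorem le_locPow (d : ℕ) (L : Submodule ℤ B) : L ≤ locPow d L := fun x hx =>
  ⟨0, by rw [pow_zero, Nat.cast_one, one_smul]; exact hx⟩

/-- At a prime not dividing `d`, inverting `d` is invisible: `(locPow d L)_q = L_q`. [folklore] -/
theorem locAt_locPow_of_not_dvd {q d : ℕ} (hq : q.Prime) (hqd : ¬ q ∣ d) (L : Submodule ℤ B) :
    locAt q (locPow d L) = locAt q L := by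
  refine le_antisymm ?_ (locAt_mono q (le_locPow d L))
  rintro x ⟨k, hk, t, ht⟩
  refine ⟨d ^ t * k, Nat.Coprime.mul_left (Nat.Coprime.pow_left t ?_) hk, ?_⟩
  · exact (Nat.coprime_comm.mp ((Nat.Prime.coprime_iff_not_dvd hq).mpr hqd))
  · rwa [Nat.cast_mul, mul_smul]

/-- At a prime dividing `d`, `locPow d L` localises to everything reachable from `L` by any
non-zero integer: if `e • x ∈ L` with `e ≠ 0` then `x ∈ (locPow d L)_p`. [folklore] -/
theorem mem_locAt_locPow_of_smul_mem {p d : ℕ} (hp : p.Prime) (hpd : p ∣ d)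
    {L : Submodule ℤ B} {x : B} {e : ℕ} (he : e ≠ 0) (hex : (e : ℤ) • x ∈ L) :
    x ∈ locAt p (locPow d L) := by
  -- write `e = p ^ a * e'` with `p ∤ e'`; then `e' • x ∈ locPow d L` via `d ^ a`.
  obtain ⟨a, e', he', hee'⟩ := Nat.exists_eq_pow_mul_and_not_dvd he p hp.ne_one
  refine ⟨e', (Nat.Prime.coprime_iff_not_dvd hp).mpr he' |>.symm, a, ?_⟩
  obtain ⟨c, hc⟩ : p ^ a ∣ d ^ a := pow_dvd_pow_of_dvd hpd a
  rw [hc, ← mul_smul, ← Nat.cast_mul, mul_comm, show e' * (p ^ a * c) = c * (p ^ a * e') by ring,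
    ← hee', Nat.cast_mul, mul_smul]
  exact L.smul_mem _ hex


/-! ### Orders as ideals of themselves -/

/-- `I ≤ I * O_r(I)`: since `1 ∈ O_r(I)`. [folklore] -/
theorem le_mul_rightOrderOf (I : Submodule ℤ B) : I ≤ I * rightOrderOf I := fun x hx => by
  simpa using Submodule.mul_mem_mul hx (one_mem_rightOrderOf I)

/-- `I * O_r(I) = I` (Vignéras I §4: `I` is a right `O_d(I)`-module). [cite: VignerasLNM800, Ch. I §4 Déf. p. 20 (ordre à droite)] -/
theorem mul_rightOrderOf (I : Submodule ℤ B) : I * rightOrderOf I = I :=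
  le_antisymm (Submodule.mul_le.mpr fun _ hm _ ha => ha _ hm) (le_mul_rightOrderOf I)

/-- `O_ℓ(I) * I = I`. [cite: VignerasLNM800, Ch. I §4 Déf. p. 20 (ordre à gauche)] -/
theorem leftOrderOf_mul (I : Submodule ℤ B) : leftOrderOf I * I = I :=
  le_antisymm (Submodule.mul_le.mpr fun _ ha _ hm => ha _ hm) fun x hx => by
    simpa using Submodule.mul_mem_mul (one_mem_leftOrderOf I) hx

/-- For an invertible right `O`-ideal, `I * O = I`. [folklore] -/
theorem IsInvertibleRightIdeal.mul_order {O I : Submodule ℤ B} (h : IsInvertibleRightIdeal O I) :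
    I * O = I := by
  rw [← h.rightOrderOf_eq, mul_rightOrderOf]

/-- The right order of an order is itself: `O_r(O) = O`. [folklore] -/
theorem IsZOrder.rightOrderOf_eq {O : Submodule ℤ B} (hO : IsZOrder O) : rightOrderOf O = O :=
  le_antisymm (fun x hx => by simpa using hx 1 hO.one_mem) fun _ hx _ hy => hO.mul_mem _ hy _ hx

/-- The left order of an order is itself: `O_ℓ(O) = O`. [folklore] -/
theorem IsZOrder.leftOrderOf_eq {O : Submodule ℤ B} (hO : IsZOrder O) : leftOrderOf O = O :=
  le_antisymm (fun x hx => by simpa using hx 1 hO.one_mem) fun _ hx _ hy => hO.mul_mem _ hx _ hy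

/-- An order is idempotent: `O * O = O`. [folklore] -/
theorem IsZOrder.mul_self {O : Submodule ℤ B} (hO : IsZOrder O) : O * O = O := by
  have h := mul_rightOrderOf O
  rwa [hO.rightOrderOf_eq] at h

/-- **An order is an invertible right ideal of itself** (with inverse `O`). [folklore] -/
theorem IsZOrder.isInvertibleRightIdeal_self {O : Submodule ℤ B} (hO : IsZOrder O) :
    IsInvertibleRightIdeal O O where
  isFullLattice := hO.isFullLattice
  rightOrderOf_eq := hO.rightOrderOf_eq
  exists_inv := ⟨O, by rw [hO.mul_self, hO.leftOrderOf_eq], hO.mul_self⟩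

/-! ### The canonical inverse `linv O I = {x | x I ⊆ O}` -/

/-- **The canonical inverse** of a lattice `I` relative to `O`: `linv O I = {x ∈ B | x I ⊆ O}`.
For an invertible right `O`-ideal this is *the* inverse `I⁻¹` of Vignéras I §4 (p. 21:
`I⁻¹ I = O_d`, `I I⁻¹ = O_g`), see `IsInvertibleRightIdeal.linv_mul`,
`IsInvertibleRightIdeal.mul_linv`. [cite: VignerasLNM800, Ch. I §4 Déf. p. 21 (inverse) and Lemme 4.3] -/
def linv (O I : Submodule ℤ B) : Submodule ℤ B where
  carrier := {x | ∀ y ∈ I, x * y ∈ O}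
  add_mem' ha hb y hy := by
    rw [add_mul]
    exact add_mem (ha y hy) (hb y hy)
  zero_mem' y _ := by
    rw [zero_mul]
    exact zero_mem O
  smul_mem' n {x} hx y hy := by
    rw [smul_mul_assoc]
    exact O.smul_mem n (hx y hy)

/-- Membership in `linv O I` (definitional). [folklore] -/
theorem mem_linv {O I : Submodule ℤ B} {x : B} : x ∈ linv O I ↔ ∀ y ∈ I, x * y ∈ O := Iff.rfl

/-- `linv O I * I ≤ O` (definition). [folklore] -/
theorem linv_mul_le (O I : Submodule ℤ B) : linv O I * I ≤ O :=
  Submodule.mul_le.mpr fun _ hx _ hy => hx _ hy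

/-- `linv O` is antitone in the ideal. [folklore] -/
theorem linv_anti (O : Submodule ℤ B) {I J : Submodule ℤ B} (h : I ≤ J) : linv O J ≤ linv O I :=
  fun _ hx y hy => hx y (h hy)

/-- Any left inverse lies in the canonical one: `I' * I ≤ O → I' ≤ linv O I`. [folklore] -/
theorem le_linv_of_mul_le {O I I' : Submodule ℤ B} (h : I' * I ≤ O) : I' ≤ linv O I :=
  fun _ hx _ hy => h (Submodule.mul_mem_mul hx hy)

/-- `linv O O = O_ℓ(O)`; for an order, `linv O O = O`. [folklore] -/
theorem IsZOrder.linv_self {O : Submodule ℤ B} (hO : IsZOrder O) : linv O O = O := by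
  have h : linv O O = leftOrderOf O := rfl
  rw [h, hO.leftOrderOf_eq]

/-- The canonical inverse of a left translate: `linv O (b • J) = (linv O J) b⁻¹`. [folklore] -/
theorem linv_units_smul (O J : Submodule ℤ B) (b : Bˣ) :
    linv O (b • J) = MulOpposite.op ((b⁻¹ : Bˣ) : B) • linv O J := by
  ext x
  rw [mem_op_units_smul_submodule_iff, inv_inv, mem_linv, mem_linv]
  constructor
  · intro h y hy
    rw [mul_assoc]
    exact h _ (Submodule.smul_mem_pointwise_smul y b J hy)
  · intro h y hy
    obtain ⟨z, hz, rfl⟩ := (Submodule.mem_smul_pointwise_iff_exists y b J).mp hy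
    rw [Units.smul_def, smul_eq_mul, ← mul_assoc]
    exact h z hz

/-! ### The multiplication rules for invertible right ideals -/

namespace IsInvertibleRightIdeal

variable {O I : Submodule ℤ B}

/-- **`I⁻¹ I = O`** for an invertible right `O`-ideal and its canonical inverse (Vignéras I §4,
p. 21). [cite: VignerasLNM800, Ch. I §4 p. 21 (règles de multiplication)] -/
theorem linv_mul (h : IsInvertibleRightIdeal O I) : linv O I * I = O := by
  refine le_antisymm (linv_mul_le O I) ?_
  obtain ⟨I', -, h₂⟩ := h.exists_inv
  calc O = I' * I := h₂.symm
    _ ≤ linv O I * I := mul_le_mul' (le_linv_of_mul_le h₂.le) le_rfl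

/-- **`I I⁻¹ = O_ℓ(I)`** for an invertible right `O`-ideal and its canonical inverse (Vignéras
I §4, p. 21). [cite: VignerasLNM800, Ch. I §4 p. 21 (règles de multiplication)] -/
theorem mul_linv (h : IsInvertibleRightIdeal O I) : I * linv O I = leftOrderOf I := by
  refine le_antisymm ?_ ?_
  · rw [Submodule.mul_le]
    intro x hx z hz y hy
    rw [mul_assoc]
    exact h.mul_mem hx (hz y hy)
  · obtain ⟨I', h₁, h₂⟩ := h.exists_inv
    calc leftOrderOf I = I * I' := h₁.symm
      _ ≤ I * linv O I := mul_le_mul' le_rfl (le_linv_of_mul_le h₂.le)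

/-- `1 ∈ I I⁻¹`. [folklore] -/
theorem one_mem_mul_linv (h : IsInvertibleRightIdeal O I) : (1 : B) ∈ I * linv O I := by
  rw [h.mul_linv]
  exact one_mem_leftOrderOf I

/-- `O ≤ linv O I * I` and in particular `1 ∈ I⁻¹ I`. [folklore] -/
theorem one_mem_linv_mul (h : IsInvertibleRightIdeal O I) (hO : (1 : B) ∈ O) :
    (1 : B) ∈ linv O I * I := by
  rw [h.linv_mul]
  exact hO

end IsInvertibleRightIdeal

/-- The canonical inverse is a left `O`-module: `O * linv O I = linv O I` (for `O` an order).
[folklore] -/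
theorem IsZOrder.mul_linv {O : Submodule ℤ B} (hO : IsZOrder O) (I : Submodule ℤ B) :
    O * linv O I = linv O I := by
  refine le_antisymm ?_ fun x hx => by simpa using Submodule.mul_mem_mul hO.one_mem hx
  rw [Submodule.mul_le]
  intro a ha z hz y hy
  rw [mul_assoc]
  exact hO.mul_mem _ ha _ (hz y hy)

/-! ### Invertibility from local data -/

/-- **Gluing criterion, local form** (the use of Vignéras III §5 A–B in the Brandt-matrix
identities): let `M` be a full lattice and `M'` a candidate inverse. Suppose that at every prime
`p` there are finitely generated lattices `J, J'` with `M_p = J_p`, `M'_p = J'_p` which are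
*inverse to each other locally at `p` with respect to `O`*: `(O_r J)_p = O_p`,
`(J J')_p = (O_ℓ J)_p`, `(J' J)_p = O_p`. Then `M` is an invertible right `O`-ideal (with inverse
`M'`): right orders, `M M'` and `M' M` are computed prime by prime (`rightOrderOf_locAt`,
`leftOrderOf_locAt`, `locAt_mul_congr`) and compared by the local–global principle. The local
witnesses need not be `O`-ideals globally (e.g. ideals of a larger order agreeing with `O` at
`p`). [cite: VignerasLNM800, Ch. III §5 A Prop. 5.1 and §5 B] -/
theorem IsInvertibleRightIdeal.of_locAt_local {O M : Submodule ℤ B} (hM : IsFullLattice B M)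
    (M' : Submodule ℤ B)
    (h : ∀ p : ℕ, p.Prime → ∃ J J' : Submodule ℤ B, J.FG ∧
      locAt p M = locAt p J ∧ locAt p M' = locAt p J' ∧
      locAt p (rightOrderOf J) = locAt p O ∧
      locAt p (J * J') = locAt p (leftOrderOf J) ∧ locAt p (J' * J) = locAt p O) :
    IsInvertibleRightIdeal O M where
  isFullLattice := hM
  rightOrderOf_eq := eq_of_forall_locAt_eq fun p hp => by
    obtain ⟨J, -, hJ, hMJ, -, hOr, -, -⟩ := h p hp
    rw [← rightOrderOf_locAt p hM.1, hMJ, rightOrderOf_locAt p hJ, hOr]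
  exists_inv := by
    refine ⟨M', eq_of_forall_locAt_eq fun p hp => ?_, eq_of_forall_locAt_eq fun p hp => ?_⟩
    · obtain ⟨J, J', hJ, hMJ, hM'J, -, hJJ', -⟩ := h p hp
      rw [locAt_mul_congr p hMJ hM'J, hJJ', ← leftOrderOf_locAt p hJ, ← hMJ,
        leftOrderOf_locAt p hM.1]
    · obtain ⟨J, J', -, hMJ, hM'J, -, -, hJ'J⟩ := h p hp
      rw [locAt_mul_congr p hM'J hMJ, hJ'J]

/-- **Gluing criterion**: let `O` be a `ℤ`-order (or any lattice), `M` a full lattice and `M'` a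
candidate inverse. If at every prime `p` there is an invertible right `O`-ideal `J` with
`M_p = J_p` and `M'_p = (J⁻¹)_p` (`J⁻¹ = linv O J`), then `M` is an invertible right `O`-ideal
(with inverse `M'`). [cite: VignerasLNM800, Ch. III §5 A Prop. 5.1 and §5 B] -/
theorem IsInvertibleRightIdeal.of_locAt {O M : Submodule ℤ B} (hM : IsFullLattice B M)
    (M' : Submodule ℤ B)
    (h : ∀ p : ℕ, p.Prime → ∃ J : Submodule ℤ B, IsInvertibleRightIdeal O J ∧
      locAt p M = locAt p J ∧ locAt p M' = locAt p (linv O J)) :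
    IsInvertibleRightIdeal O M :=
  IsInvertibleRightIdeal.of_locAt_local hM M' fun p hp => by
    obtain ⟨J, hJ, hMJ, hM'J⟩ := h p hp
    exact ⟨J, linv O J, hJ.isFullLattice.1, hMJ, hM'J, by rw [hJ.rightOrderOf_eq],
      by rw [hJ.mul_linv], by rw [hJ.linv_mul]⟩

/-- **Corollary**: a full lattice that has, at every prime, the localisation of one and the same
invertible right `O`-ideal `I` is invertible (with inverse `linv O I`). [folklore] -/
theorem IsInvertibleRightIdeal.of_forall_locAt_eq {O M I : Submodule ℤ B} (hM : IsFullLattice B M)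
    (hI : IsInvertibleRightIdeal O I) (h : ∀ p : ℕ, p.Prime → locAt p M = locAt p I) :
    IsInvertibleRightIdeal O M :=
  IsInvertibleRightIdeal.of_locAt hM (linv O I) fun p hp => ⟨I, hI, h p hp, rfl⟩

end Literature.NumberTheory.Automorphic

end
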